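import Summits.CriticalPhenomena.PercolationContinuityZ3.Theorems.PercNearOneGluingNoHeavyLowerTailSahiThreeCopyBlocks

/-!
# `NoHeavyLowerTail` (crux stmt-CriticalPhenomena-4575), Sahi programme: **3C-SAHI LOCALISES TO THE JOINT SUPPORT OF TWO OF
# THE THREE FUNCTIONS** — if `f, g` depend only on `d` of the coordinates, then for EVERY `h` on the big cube
# `c_{(b_f,b_b)}(f,g,h) = c_{b_b}(f,g, M_{b_f}h)` with the THREE-COPY MARGINAL `M_{b_f}h` (a nonnegative monotone function of
# the `d` coordinates); hence 3C-SAHI on `{0,1}^d` (third slot a general monotone function) gives 3C-SAHI in every dimension for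
# all triples two of whose members live on `d` common coordinates

Support file (Sahi cell, seat `prim-sahi-p1`, generation 55; `--supports stmt-CriticalPhenomena-4575`); companion of `…SahiThreeCopy`
(generation 53) and `…SahiThreeCopyBlocks` (generation 54: `appendProf`).

THE OBSERVATION (law level it is one line: `E₃(1_A,1_B,1_C) = E₃(1_A,1_B, E[1_C | 𝓕_J])` when `A, B` are `𝓕_J`-measurable, and the
conditional expectation of an increasing event is increasing).  Coefficientwise: let `F = liftB m f`, `G = liftB m g` be functions of
the `d` back coordinates only (`f, g : {0,1}^d → ℝ` lifted to `{0,1}^{d+m}`) and `h : {0,1}^{d+m} → ℝ` arbitrary.  The arrangements of a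
concatenated profile `(b_f, b_b)` are pairs (front arrangement, back arrangement); in every one of the five terms of `c_b` the function
`h` occupies ONE copy, and summing over the front arrangements with `h` read in that copy produces the same back function whichever
copy it is — the THREE-COPY MARGINAL `marg m b_f h : {0,1}^d → ℝ`, `(marg h)(x) = Σ_{front arrangements (y¹,y²,y³) of b_f} h(y¹,x)`
(defined by peeling front coordinates: weights `1; (1,2); (2,1); 1` for front profile entries `0; 1; 2; 3`).
* `liftB`, `sec_liftB`, `liftB_mul/one/nonneg/monotone`; `marg`, `marg_nonneg`, `marg_monotone`;
* ★ `N3_liftB_mul` — `N_{(b_f,b_b)}(F·h; G; W) = N_{b_b}(f·marg h; g; w)` for lifted `F, G, W` (induction on `m` through `N3_cons`);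
* ★★ `tc_liftB` — **`c_{(b_f,b_b)}(F, G, h) = c_{b_b}(f, g, marg h)`**;
* ★★ `tc_liftB_nonneg` / `tc_liftB_nonneg_all` — if `c_{b'}(f,g,H) ≥ 0` for every profile `b'` of `{0,1}^d` and every nonnegative
  monotone `H`, then `c_B(F,G,h) ≥ 0` for every nonnegative monotone `h` on `{0,1}^{d+m}` and every profile `B`;
  `tc_liftB_nonneg_of_dim` — 3C-SAHI in dimension `d` (functions form) ⇒ 3C-SAHI for all triples with two `d`-supported slots, any
  dimension (other coordinate positions: `…SubstitutionCorollaries.tc_reindex`).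
With `…CubeFour` (`tc_nonneg_of_le_four`) this settles — in the companion file `…MarginalLeFour` (computational) — 3C-SAHI, hence Kahn's
inequality under every product measure, for EVERY triple in which two of the three functions depend on at most FOUR common coordinates,
the third being an arbitrary nonnegative monotone function of any number of variables (e.g. `(x₁∨x₂, x₂∨x₃, Maj₉)`); with the census's
exhaustive `d = 5` (CENSUS §190) the same holds at evidence level for five.  Nothing conjectural is used.  [this work]
-/

namespace Summit.CriticalPhenomena.PercolationContinuityZ3.Theorems.SahiThreeCopy

open Finset Function Literature.Combinatorics.Sahi2008
open scoped BigOperators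

noncomputable section

variable {d : ℕ}

/-! ### §1 Lifting back functions and the three-copy marginal -/

/-- Lift a function of the `d` back coordinates to `{0,1}^{d+m}` (constant in the `m` front coordinates). [this work] -/
def liftB : (m : ℕ) → (Pt d → ℝ) → (Pt (d + m) → ℝ)
  | 0, f => f
  | m + 1, f => fun w => liftB m f (Fin.tail w)

/-- Sections of a lifted function do not depend on the front bit. [this work] -/
theorem sec_liftB (m : ℕ) (f : Pt d → ℝ) (ε : Bool) : sec (liftB (m + 1) f) ε = liftB m f := by
  funext x; simp [sec, liftB, Fin.tail_cons]

/-- Lifting is multiplicative. [this work] -/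
theorem liftB_mul : ∀ (m : ℕ) (f g : Pt d → ℝ), liftB m (f * g) = liftB m f * liftB m g
  | 0, f, g => rfl
  | m + 1, f, g => by funext w; simp only [liftB, Pi.mul_apply, liftB_mul m]

/-- Lifting fixes `1`. [this work] -/
theorem liftB_one : ∀ m : ℕ, liftB m (1 : Pt d → ℝ) = 1
  | 0 => rfl
  | m + 1 => by funext w; simp only [liftB, liftB_one m, Pi.one_apply]

/-- Lifting preserves nonnegativity. [this work] -/
theorem liftB_nonneg : ∀ (m : ℕ) {f : Pt d → ℝ}, (∀ x, 0 ≤ f x) → ∀ w, 0 ≤ liftB m f w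
  | 0, _, hf, w => hf w
  | m + 1, _, hf, _ => liftB_nonneg m hf _

/-- Lifting preserves monotonicity. [this work] -/
theorem liftB_monotone : ∀ (m : ℕ) {f : Pt d → ℝ}, Monotone f → Monotone (liftB m f)
  | 0, _, hf => hf
  | m + 1, _, hf => fun _ _ hww' => liftB_monotone m hf fun i => hww' i.succ

/-- The THREE-COPY MARGINAL of `h : {0,1}^{d+m} → ℝ` over the front profile `b_f`: `(marg h)(x) = Σ_{front arrangements} h(y¹, x)`,
by peeling front coordinates (front entry `0 ↦ h⁰`, `1 ↦ h¹ + 2h⁰`, `2 ↦ 2h¹ + h⁰`, `3 ↦ h¹`, `≥ 4 ↦ 0`). [this work] -/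
def marg : (m : ℕ) → (Fin m → ℕ) → (Pt (d + m) → ℝ) → (Pt d → ℝ)
  | 0, _, h => h
  | m + 1, bf, h =>
    match bf 0 with
    | 0 => marg m (Fin.tail bf) (sec h false)
    | 1 => marg m (Fin.tail bf) (sec h true) + (2 : ℝ) • marg m (Fin.tail bf) (sec h false)
    | 2 => (2 : ℝ) • marg m (Fin.tail bf) (sec h true) + marg m (Fin.tail bf) (sec h false)
    | 3 => marg m (Fin.tail bf) (sec h true)
    | _ + 4 => 0

/-- The marginal of a nonnegative function is nonnegative. [this work] -/
theorem marg_nonneg : ∀ (m : ℕ) (bf : Fin m → ℕ) {h : Pt (d + m) → ℝ}, (∀ w, 0 ≤ h w) → ∀ x, 0 ≤ marg m bf h x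
  | 0, _, _, hh, x => hh x
  | m + 1, bf, h, hh, x => by
    have h0 := marg_nonneg m (Fin.tail bf) (sec_nonneg hh false)
    have h1 := marg_nonneg m (Fin.tail bf) (sec_nonneg hh true)
    match hk : bf 0 with
    | 0 => simp only [marg, hk]; exact h0 x
    | 1 => simp only [marg, hk, Pi.add_apply, Pi.smul_apply, smul_eq_mul]; nlinarith [h0 x, h1 x]
    | 2 => simp only [marg, hk, Pi.add_apply, Pi.smul_apply, smul_eq_mul]; nlinarith [h0 x, h1 x]
    | 3 => simp only [marg, hk]; exact h1 x
    | k + 4 => simp only [marg, hk, Pi.zero_apply]; exact le_rfl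

/-- The marginal of a monotone function is monotone. [this work] -/
theorem marg_monotone : ∀ (m : ℕ) (bf : Fin m → ℕ) {h : Pt (d + m) → ℝ}, Monotone h → Monotone (marg m bf h)
  | 0, _, _, hh => hh
  | m + 1, bf, h, hh => by
    have h0 := marg_monotone m (Fin.tail bf) (sec_monotone hh false)
    have h1 := marg_monotone m (Fin.tail bf) (sec_monotone hh true)
    intro x y hxy
    match hk : bf 0 with
    | 0 => simp only [marg, hk]; exact h0 hxy
    | 1 =>
      simp only [marg, hk, Pi.add_apply, Pi.smul_apply, smul_eq_mul]
      nlinarith [h0 hxy, h1 hxy]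
    | 2 =>
      simp only [marg, hk, Pi.add_apply, Pi.smul_apply, smul_eq_mul]
      nlinarith [h0 hxy, h1 hxy]
    | 3 => simp only [marg, hk]; exact h1 hxy
    | k + 4 => simp only [marg, hk, Pi.zero_apply]; exact le_rfl

/-! ### §2 Integrating out the front block -/

/-- Linearity helpers for the first slot. [this work] -/
theorem N3_mul_add_left (b : Fin d → ℕ) (u φ ψ v w : Pt d → ℝ) :
    N3 b (u * (φ + ψ)) v w = N3 b (u * φ) v w + N3 b (u * ψ) v w := by
  rw [mul_add, N3_add_left]

/-- Linearity helpers for the first slot (scalar). [this work] -/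
theorem N3_mul_smul_left (b : Fin d → ℕ) (c : ℝ) (u φ v w : Pt d → ℝ) :
    N3 b (u * (c • φ)) v w = c * N3 b (u * φ) v w := by
  rw [mul_smul_comm, N3_smul_left]

/-- ★ **Integrating out the front block**: for lifted `u, v, w` and any `h`,
`N_{(b_f,b_b)}(U·h; V; W) = N_{b_b}(u·marg h; v; w)`. [this work] -/
theorem N3_liftB_mul : ∀ (m : ℕ) (bf : Fin m → ℕ) (bb : Fin d → ℕ) (u v w : Pt d → ℝ) (h : Pt (d + m) → ℝ),
    N3 (appendProf m bf bb) (liftB m u * h) (liftB m v) (liftB m w) = N3 bb (u * marg m bf h) v w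
  | 0, bf, bb, u, v, w, h => rfl
  | m + 1, bf, bb, u, v, w, h => by
    have IH : ∀ ε : Bool, N3 (appendProf m (Fin.tail bf) bb) (liftB m u * sec h ε) (liftB m v) (liftB m w) =
        N3 bb (u * marg m (Fin.tail bf) (sec h ε)) v w := fun ε => N3_liftB_mul m (Fin.tail bf) bb u v w (sec h ε)
    simp only [appendProf]
    match hk : bf 0 with
    | 0 =>
      rw [N3_cons_zero]
      simp only [sec_mul, sec_liftB, IH, marg, hk]
    | 1 =>
      rw [N3_cons_one]
      simp only [sec_mul, sec_liftB, IH, marg, hk, N3_mul_add_left, N3_mul_smul_left]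
      ring
    | 2 =>
      rw [N3_cons_two]
      simp only [sec_mul, sec_liftB, IH, marg, hk, N3_mul_add_left, N3_mul_smul_left]
      ring
    | 3 =>
      rw [N3_cons_three]
      simp only [sec_mul, sec_liftB, IH, marg, hk]
    | k + 4 =>
      rw [N3_cons_add_four]
      simp only [marg, hk, mul_zero, N3_zero_left]

/-- ★★ **The three-copy Sahi coefficient only sees the marginal of the third function**:
`c_{(b_f,b_b)}(liftB f, liftB g, h) = c_{b_b}(f, g, marg h)`. [this work] -/
theorem tc_liftB (m : ℕ) (bf : Fin m → ℕ) (bb : Fin d → ℕ) (f g : Pt d → ℝ) (h : Pt (d + m) → ℝ) :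
    tc (appendProf m bf bb) (liftB m f) (liftB m g) h = tc bb f g (marg m bf h) := by
  set H := marg m bf h with hH
  have key := fun u v w => N3_liftB_mul m bf bb u v w h
  -- the five terms of `tc`, with `h` moved to the first slot of a lifted product
  have t1 : N3 (appendProf m bf bb) (liftB m f * liftB m g * h) 1 1 = N3 bb (f * g * H) 1 1 := by
    rw [← liftB_mul, ← liftB_one m, key, hH]
  have t2 : N3 (appendProf m bf bb) (liftB m f) (liftB m g * h) 1 = N3 bb f (g * H) 1 := by
    rw [N3_comm12, ← liftB_one m, key, N3_comm12, hH]
  have t3 : N3 (appendProf m bf bb) (liftB m g) (liftB m f * h) 1 = N3 bb g (f * H) 1 := by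
    rw [N3_comm12, ← liftB_one m, key, N3_comm12, hH]
  have t4 : N3 (appendProf m bf bb) h (liftB m f * liftB m g) 1 = N3 bb H (f * g) 1 := by
    have e : h = liftB m 1 * h := by rw [liftB_one, one_mul]
    rw [e, ← liftB_mul, ← liftB_one m, key, one_mul, hH]
  have t5 : N3 (appendProf m bf bb) (liftB m f) (liftB m g) h = N3 bb f g H := by
    have e : h = liftB m 1 * h := by rw [liftB_one, one_mul]
    rw [N3_comm13, e, key, one_mul, N3_comm13, hH]
  unfold tc
  rw [t1, t2, t3, t4, t5]

/-- ★★ **Localisation of 3C-SAHI to the joint support of two slots**: if `c_{b'}(f,g,H) ≥ 0` for every profile `b'` of `{0,1}^d`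
and every nonnegative monotone `H : {0,1}^d → ℝ`, then for every nonnegative monotone `h` on `{0,1}^{d+m}`,
`c_{(b_f,b_b)}(liftB f, liftB g, h) ≥ 0`. [this work] -/
theorem tc_liftB_nonneg (m : ℕ) (bf : Fin m → ℕ) (bb : Fin d → ℕ) {f g : Pt d → ℝ}
    (H : ∀ (b' : Fin d → ℕ) (H : Pt d → ℝ), (∀ x, 0 ≤ H x) → Monotone H → 0 ≤ tc b' f g H) {h : Pt (d + m) → ℝ}
    (hh : ∀ w, 0 ≤ h w) (hhm : Monotone h) : 0 ≤ tc (appendProf m bf bb) (liftB m f) (liftB m g) h := by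
  rw [tc_liftB]
  exact H bb _ (marg_nonneg m bf hh) (marg_monotone m bf hhm)

/-- The same at every profile of `{0,1}^{d+m}`. [this work] -/
theorem tc_liftB_nonneg_all (m : ℕ) {f g : Pt d → ℝ}
    (H : ∀ (b' : Fin d → ℕ) (H : Pt d → ℝ), (∀ x, 0 ≤ H x) → Monotone H → 0 ≤ tc b' f g H) {h : Pt (d + m) → ℝ}
    (hh : ∀ w, 0 ≤ h w) (hhm : Monotone h) (B : Fin (d + m) → ℕ) : 0 ≤ tc B (liftB m f) (liftB m g) h := by
  obtain ⟨bf, bb, rfl⟩ := exists_appendProf m B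
  exact tc_liftB_nonneg m bf bb H hh hhm

/-- **3C-SAHI in dimension `d` gives 3C-SAHI for all triples with two `d`-supported slots, in every dimension**: if `c ≥ 0` for all
nonnegative monotone triples on `{0,1}^d`, then for nonnegative monotone `f, g : {0,1}^d → ℝ` and ANY nonnegative monotone
`h : {0,1}^{d+m} → ℝ`, `c_B(liftB f, liftB g, h) ≥ 0` at every profile `B`. [this work] -/
theorem tc_liftB_nonneg_of_dim (m : ℕ)
    (Hd : ∀ (b' : Fin d → ℕ) (u v w : Pt d → ℝ), (∀ x, 0 ≤ u x) → (∀ x, 0 ≤ v x) → (∀ x, 0 ≤ w x) →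
      Monotone u → Monotone v → Monotone w → 0 ≤ tc b' u v w)
    {f g : Pt d → ℝ} (hf : ∀ x, 0 ≤ f x) (hfm : Monotone f) (hg : ∀ x, 0 ≤ g x) (hgm : Monotone g)
    {h : Pt (d + m) → ℝ} (hh : ∀ w, 0 ≤ h w) (hhm : Monotone h) (B : Fin (d + m) → ℕ) :
    0 ≤ tc B (liftB m f) (liftB m g) h :=
  tc_liftB_nonneg_all m (fun b' H hH hHm => Hd b' f g H hf hg hH hfm hgm hHm) hh hhm B

end

end Summit.CriticalPhenomena.PercolationContinuityZ3.Theorems.SahiThreeCopy
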